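import Literature.AlgebraicGeometry.Motives.PicardQuarticHypersurface
import Literature.AlgebraicGeometry.Motives.HypersurfaceCharts
import Literature.AlgebraicGeometry.Motives.PicardCurveMuOrdinaryReduction
import Literature.AlgebraicGeometry.Motives.VarietiesGeometricallyIntegralProofs
import Literature.AlgebraicGeometry.Motives.VarietiesProperProofs
import Literature.NumberTheory.GaloisRepresentations.SuperellipticFunctionField
import HarnessLib

/-!
# The affine chart `z ≠ 0` of the Picard quartic is `Spec K[x][y]/(y³ - f)`; Picard curves exist

For a separable quartic `g ∈ K[X]` (`3 ≠ 0` in `K`) and the smooth plane quartic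
`X_F = V₊(y³z - z⁴g(x/z)) ⊂ ℙ²_K` of `Motives/PicardQuarticHypersurface`:

* `affineRing g = K[x][y]/(y³ - g)` (Mathlib `AdjoinRoot` of `Y³ - C g ∈ K[x][Y]`; literally the
  tree's `Motives.picardAffineRing f M` when `g = f.map (Int.castRingHom M)`), a domain
  (`isDomain_affineRing`: `Y³ - g` is irreducible over `K(x)` by the tree's
  `irreducible_superellipticPoly`, hence over `K[x]` by Gauss's lemma).
* `chartRingEquivAffineRing` — **the chart ring `A₂ = K[x/z, y/z]/√(F(x/z, y/z, 1))` of `X_F ∩ D₊(z)`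
  (`Motives/HypersurfaceCharts`) is `K`-isomorphic to `K[x][y]/(y³ - g)`**: `toChartRing`
  (`x ↦ x/z`, `y ↦ y/z`, Mathlib `AdjoinRoot.lift`) and `ofChartRing` (the universal property
  `SmoothHypersurface.liftVec` of the chart ring into reduced algebras, at the vector `(x, y, 1)`)
  are inverse (`algHom_ext_tautVec`; ring-hom extensionality on `K[x][Y]`).
* `affineChart` — the open immersion `Spec K[x][y]/(y³ - g) → X_F` onto `z ≠ 0`
  (`isOpenImmersion_affineChart_left`).
* `isPicardCurve_hypersurface_picardForm`, `exists_isPicardCurve` — **the hypothesis structure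
  `Motives.IsPicardCurve f C` of `Motives/PicardCurveMuOrdinaryReduction` is inhabited**: for
  `f ∈ ℤ[X]` with separable quartic image in `M[X]` and `3 ≠ 0` in `M`, `X_F` is smooth of relative
  dimension `1`, proper (`IsSmoothProjective.isProper_holds`), integral
  (`IsSmoothProjective.isIntegral_holds`) and contains the affine Picard curve as an open subscheme —
  it is THE smooth projective model of `y³ = f(x)` in the sense of that file (Hartshorne I Ex. 5.8,
  II Example 3.2.6; Bouw–Koutsianas–Sijsling–Wewers §1).

Everything is proved; no named facts (D-0026). Not here: the function field of `X_F`
(`= Frac K[x][y]/(y³ - g) = K(x)[y]/(y³ - g)`) and its places.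

## References

* R. Hartshorne, *Algebraic Geometry*, GTM 52 (1977): I Ex. 5.8, II Example 3.2.6, II Prop. 2.5.
  [Hartshorne1977]
* I. Bouw, A. Koutsianas, J. Sijsling, S. Wewers, *Conductor and discriminant of Picard curves*,
  J. LMS 102 (2020), §1 Def. 1 and Lemma 3 (arXiv:1902.09624). [BouwEtAl2020]
-/

noncomputable section

open MvPolynomial

universe u

namespace Literature.AlgebraicGeometry.Motives.PicardQuartic

/-! ### The affine chart `z ≠ 0`: `A₂ ≅ K[x][y]/(y³ - f)` -/

section AffineChart

open SmoothHypersurface CategoryTheory _root_.AlgebraicGeometry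

variable {K : Type u} [Field K] (g : Polynomial K)

/-- The polynomial `Y³ - g(x) ∈ K[x][Y]`. [folklore] -/
abbrev cubicPoly : Polynomial (Polynomial K) := Polynomial.X ^ 3 - Polynomial.C g

/-- The affine coordinate ring `K[x][y]/(y³ - g(x))` of the Picard curve `y³ = g(x)` (Mathlib
`AdjoinRoot` of `Y³ - C g ∈ K[x][Y]`; for `g = f.map (Int.castRingHom M)` this is literally
`Motives.picardAffineRing f M`). [folklore] -/
abbrev affineRing : Type u := AdjoinRoot (cubicPoly g)

/-- `y³ = g(x)` in `K[x][y]/(y³ - g)`. [folklore] -/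
theorem root_pow_three : (AdjoinRoot.root (cubicPoly g)) ^ 3 = AdjoinRoot.of _ g := by
  have h := AdjoinRoot.eval₂_root (cubicPoly g)
  rw [Polynomial.eval₂_sub, Polynomial.eval₂_pow, Polynomial.eval₂_X, Polynomial.eval₂_C] at h
  exact sub_eq_zero.mp h

/-- `Y³ - g(x)` is irreducible in `K[x][Y]` for `g` separable non-constant (Gauss's lemma from the
irreducibility over `K(x)`, the tree's `irreducible_superellipticPoly`). [folklore] -/
theorem irreducible_cubicPoly (hsep : g.Separable) (hdeg : 0 < g.natDegree) :
    Irreducible (cubicPoly g) := by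
  have hmon : (cubicPoly g).Monic := Polynomial.monic_X_pow_sub_C g three_ne_zero
  rw [hmon.irreducible_iff_irreducible_map_fraction_map (K := RatFunc K)]
  have h := Literature.NumberTheory.GaloisRepresentations.irreducible_superellipticPoly K K g
    Nat.prime_three hsep hdeg
  rw [Literature.NumberTheory.GaloisRepresentations.superellipticPoly, Algebra.algebraMap_self,
    Polynomial.map_id] at h
  simpa [cubicPoly, Polynomial.map_sub, Polynomial.map_pow, Polynomial.map_X] using h

/-- `K[x][y]/(y³ - g)` is a domain for `g` separable non-constant. [folklore] -/
theorem isDomain_affineRing (hsep : g.Separable) (hdeg : 0 < g.natDegree) : IsDomain (affineRing g) :=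
  AdjoinRoot.isDomain_of_prime (irreducible_cubicPoly g hsep hdeg).prime

/-- The vector `(x, y, 1)` over the affine ring. [folklore] -/
def affineVec : Fin 3 → affineRing g :=
  ![AdjoinRoot.of (cubicPoly g) Polynomial.X, AdjoinRoot.root (cubicPoly g), 1]

/-- `(x, y, 1)₀ = x`. [folklore] -/
@[simp] theorem affineVec_zero : affineVec g 0 = AdjoinRoot.of (cubicPoly g) Polynomial.X := rfl
/-- `(x, y, 1)₁ = y`. [folklore] -/
@[simp] theorem affineVec_one : affineVec g 1 = AdjoinRoot.root (cubicPoly g) := rfl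
/-- `(x, y, 1)₂ = 1`. [folklore] -/
@[simp] theorem affineVec_two : affineVec g 2 = 1 := rfl

/-- `g(x) ∈ K[x][y]/(y³ - g)` is `aeval x g`. [folklore] -/
theorem aeval_of_X : Polynomial.aeval (AdjoinRoot.of (cubicPoly g) Polynomial.X) g = AdjoinRoot.of _ g := by
  change Polynomial.aeval ((IsScalarTower.toAlgHom K (Polynomial K) (affineRing g)) Polynomial.X) g =
    (IsScalarTower.toAlgHom K (Polynomial K) (affineRing g)) g
  rw [Polynomial.aeval_algHom_apply, Polynomial.aeval_X_left_apply]

/-- `F(x, y, 1) = 0` in the affine ring (`deg g ≤ 4`). [folklore] -/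
theorem aeval_affineVec_picardForm (hg : g.natDegree ≤ 4) : aeval (affineVec g) (picardForm g) = 0 := by
  have : affineVec g = ![AdjoinRoot.of (cubicPoly g) Polynomial.X, AdjoinRoot.root (cubicPoly g), 1] := rfl
  rw [this, aeval_picardForm_vecCons_one g hg, root_pow_three, aeval_of_X, sub_self]


variable {g}

/-- `(x, y, 1)₂` is a unit. [folklore] -/
theorem isUnit_aeval_affineVec : IsUnit (aeval (affineVec g) (X 2 : MvPolynomial (Fin 3) K)) := by
  rw [aeval_X, affineVec_two]
  exact isUnit_one

/-- On the chart `z ≠ 0` the tautological vector `t = (x/z, y/z, 1)` satisfies `t₁³ = g(t₀)`.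
[folklore] -/
theorem tautVec_one_pow_three (hg : g.natDegree ≤ 4) :
    tautVec (picardForm g) 2 (isHomogeneous_picardForm g) 1 ^ 3 =
      Polynomial.aeval (tautVec (picardForm g) 2 (isHomogeneous_picardForm g) 0) g := by
  have h := aeval_tautVec_eq_zero (picardForm g) 2 (isHomogeneous_picardForm g)
  rwa [aeval_picardForm, aeval_quarticHom_of_eq_one g hg _ (tautVec_self _ _ _), tautVec_self, mul_one,
    sub_eq_zero] at h

/-- `Y³ - g(x)` dies under `x ↦ x/z, Y ↦ y/z`. [folklore] -/
theorem eval₂_cubicPoly_tautVec (hg : g.natDegree ≤ 4) :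
    Polynomial.eval₂
      (Polynomial.aeval (tautVec (picardForm g) 2 (isHomogeneous_picardForm g) 0) : Polynomial K →ₐ[K] _).toRingHom
      (tautVec (picardForm g) 2 (isHomogeneous_picardForm g) 1) (cubicPoly g) = 0 := by
  rw [Polynomial.eval₂_sub, Polynomial.eval₂_pow, Polynomial.eval₂_X, Polynomial.eval₂_C,
    tautVec_one_pow_three hg, sub_eq_zero]
  rfl

/-- **`K[x][y]/(y³ - g) → A₂`**, `x ↦ x/z`, `y ↦ y/z` (Mathlib `AdjoinRoot.lift`). [folklore] -/
def toChartRing (hg : g.natDegree ≤ 4) :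
    affineRing g →ₐ[K] ChartRing (picardForm g) 2 (isHomogeneous_picardForm g) where
  __ := AdjoinRoot.lift
      (Polynomial.aeval (tautVec (picardForm g) 2 (isHomogeneous_picardForm g) 0) : Polynomial K →ₐ[K] _).toRingHom
      (tautVec (picardForm g) 2 (isHomogeneous_picardForm g) 1) (eval₂_cubicPoly_tautVec hg)
  commutes' c := by
    simp only [RingHom.toMonoidHom_eq_coe, OneHom.toFun_eq_coe, MonoidHom.toOneHom_coe, MonoidHom.coe_coe]
    rw [AdjoinRoot.algebraMap_eq', RingHom.comp_apply, AdjoinRoot.lift_of]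
    change Polynomial.aeval _ (algebraMap K (Polynomial K) c) = _
    rw [Polynomial.algebraMap_eq, Polynomial.aeval_C]

/-- `toChartRing` on `K[x]`: `q(x) ↦ q(x/z)`. [folklore] -/
theorem toChartRing_of (hg : g.natDegree ≤ 4) (q : Polynomial K) :
    toChartRing hg (AdjoinRoot.of _ q) =
      Polynomial.aeval (tautVec (picardForm g) 2 (isHomogeneous_picardForm g) 0) q := by
  change AdjoinRoot.lift _ _ (eval₂_cubicPoly_tautVec hg) (AdjoinRoot.of _ q) = _
  rw [AdjoinRoot.lift_of]
  rfl

/-- `toChartRing y = y/z`. [folklore] -/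
theorem toChartRing_root (hg : g.natDegree ≤ 4) :
    toChartRing hg (AdjoinRoot.root _) = tautVec (picardForm g) 2 (isHomogeneous_picardForm g) 1 := by
  change AdjoinRoot.lift _ _ (eval₂_cubicPoly_tautVec hg) (AdjoinRoot.root _) = _
  rw [AdjoinRoot.lift_root]

section Equiv

variable (hsep : g.Separable) (hg : g.natDegree = 4)
include hsep hg

/-- **`A₂ → K[x][y]/(y³ - g)`**, `xⱼ/x₂ ↦ (x, y, 1)ⱼ` (the universal property `liftVec` of the chart
ring into the reduced algebra `K[x][y]/(y³ - g)`, a domain for `g` separable). [folklore] -/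
def ofChartRing : ChartRing (picardForm g) 2 (isHomogeneous_picardForm g) →ₐ[K] affineRing g :=
  haveI := isDomain_affineRing g hsep (by omega)
  liftVec (picardForm g) 2 (isHomogeneous_picardForm g) (affineVec g) isUnit_aeval_affineVec
    (aeval_affineVec_picardForm g hg.le)

/-- `ofChartRing (xⱼ/x₂) = (x, y, 1)ⱼ`. [folklore] -/
theorem ofChartRing_tautVec (j : Fin 3) :
    ofChartRing hsep hg (tautVec (picardForm g) 2 (isHomogeneous_picardForm g) j) = affineVec g j := by
  haveI := isDomain_affineRing g hsep (by omega)
  rw [ofChartRing, liftVec_tautVec]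
  have h1 : (isUnit_aeval_affineVec (g := g)).unit = 1 := Units.ext (by rw [IsUnit.unit_spec]; simp)
  rw [h1, inv_one, Units.val_one, mul_one]

/-- `toChartRing ∘ ofChartRing = id` (check on the tautological vector). [folklore] -/
theorem toChartRing_comp_ofChartRing :
    (toChartRing hg.le).comp (ofChartRing hsep hg) = AlgHom.id K _ := by
  refine algHom_ext_tautVec (picardForm g) 2 (isHomogeneous_picardForm g) fun j => ?_
  rw [AlgHom.comp_apply, ofChartRing_tautVec, AlgHom.id_apply]
  fin_cases j
  · simp [toChartRing_of]
  · simp [toChartRing_root]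
  · simp

/-- `ofChartRing ∘ toChartRing = id` (check on `K`, `x` and `y`). [folklore] -/
theorem ofChartRing_comp_toChartRing :
    (ofChartRing hsep hg).comp (toChartRing hg.le) = AlgHom.id K _ := by
  apply AlgHom.coe_ringHom_injective
  refine Ideal.Quotient.ringHom_ext (Polynomial.ringHom_ext' (Polynomial.ringHom_ext' ?_ ?_) ?_)
  · ext c
    exact ((ofChartRing hsep hg).comp (toChartRing hg.le)).commutes c
  · change ofChartRing hsep hg (toChartRing hg.le (AdjoinRoot.of _ Polynomial.X)) = AdjoinRoot.of _ Polynomial.X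
    rw [toChartRing_of, Polynomial.aeval_X, ofChartRing_tautVec, affineVec_zero]
  · change ofChartRing hsep hg (toChartRing hg.le (AdjoinRoot.root _)) = AdjoinRoot.root _
    rw [toChartRing_root, ofChartRing_tautVec, affineVec_one]

/-- **The affine chart `z ≠ 0` of the Picard quartic is `Spec K[x][y]/(y³ - g)`**:
`A₂ = K[x/z, y/z]/√(F(x/z, y/z, 1)) ≅ K[x][y]/(y³ - g)` as `K`-algebras (`g` a separable quartic).
[folklore] -/
def chartRingEquivAffineRing : ChartRing (picardForm g) 2 (isHomogeneous_picardForm g) ≃ₐ[K] affineRing g :=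
  AlgEquiv.ofAlgHom (ofChartRing hsep hg) (toChartRing hg.le) (ofChartRing_comp_toChartRing hsep hg)
    (toChartRing_comp_ofChartRing hsep hg)

/-- **The open immersion `Spec K[x][y]/(y³ - g) → X_F`** onto the chart `z ≠ 0`. [folklore] -/
def affineChart : specOver K (affineRing g) ⟶ hypersurface (picardForm g) :=
  specOverOfAlgHom (chartRingEquivAffineRing hsep hg).toAlgHom ≫
    chart (picardForm g) 2 (isHomogeneous_picardForm g) four_pos

/-- The affine chart is an open immersion (an isomorphism `Spec K[x][y]/(y³ - g) ≅ Spec A₂` followed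
by the open immersion `Spec A₂ → X_F` of `Motives/HypersurfaceCharts`). [folklore] -/
instance isOpenImmersion_affineChart_left : IsOpenImmersion (affineChart hsep hg).left := by
  have : IsIso (specOverOfAlgHom (chartRingEquivAffineRing hsep hg).toAlgHom).left := by
    rw [specOverOfAlgHom_left]
    change IsIso (Spec.map (chartRingEquivAffineRing hsep hg).toRingEquiv.toCommRingCatIso.hom)
    infer_instance
  change IsOpenImmersion (specOverOfAlgHom (chartRingEquivAffineRing hsep hg).toAlgHom ≫
    chart (picardForm g) 2 (isHomogeneous_picardForm g) four_pos).left
  rw [Over.comp_left]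
  infer_instance

end Equiv

/-- **The smooth plane quartic IS the Picard curve** (`Motives.IsPicardCurve`): for `f ∈ ℤ[X]` whose
image in `M[X]` is a separable quartic, `3 ≠ 0` in `M`, the hypersurface `V₊(y³z - z⁴f(x/z))` is
smooth of relative dimension `1`, proper, integral, and contains the affine Picard curve
`Spec M[x][y]/(y³ - f)` as the open `z ≠ 0` — so the hypothesis structure `IsPicardCurve f C` of
`Motives/PicardCurveMuOrdinaryReduction` is inhabited. [cite: Hartshorne1977, I Ex. 5.8 and II Example 3.2.6] -/
theorem isPicardCurve_hypersurface_picardForm (f : Polynomial ℤ) {M : Type} [Field M] (h3 : (3 : M) ≠ 0)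
    (hf : (f.map (Int.castRingHom M)).natDegree = 4) (hsep : (f.map (Int.castRingHom M)).Separable) :
    IsPicardCurve f (hypersurface (picardForm (f.map (Int.castRingHom M)))) where
  smooth := (isSmoothProjective_hypersurface_picardForm h3 hf hsep).smoothOfRelativeDimension
  isProper := IsSmoothProjective.isProper_holds (isSmoothProjective_hypersurface_picardForm h3 hf hsep)
  isIntegral := IsSmoothProjective.isIntegral_holds (isSmoothProjective_hypersurface_picardForm h3 hf hsep)
  exists_isOpenImmersion := ⟨affineChart hsep hf, isOpenImmersion_affineChart_left hsep hf⟩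

/-- **Picard curves exist**: `∃ C, IsPicardCurve f C` over every field `M` with `3 ≠ 0` in which `f`
stays a separable quartic. [cite: Hartshorne1977, I Ex. 5.8 and II Example 3.2.6] -/
theorem exists_isPicardCurve (f : Polynomial ℤ) {M : Type} [Field M] (h3 : (3 : M) ≠ 0)
    (hf : (f.map (Int.castRingHom M)).natDegree = 4) (hsep : (f.map (Int.castRingHom M)).Separable) :
    ∃ C : SchemeOver M, IsPicardCurve f C :=
  ⟨_, isPicardCurve_hypersurface_picardForm f h3 hf hsep⟩

end AffineChart

end Literature.AlgebraicGeometry.Motives.PicardQuartic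

end
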